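import Mathlib.Data.ZMod.Basic
import Mathlib.Algebra.Group.Pointwise.Finset.Basic
import Mathlib.Algebra.Group.Subgroup.Basic
import Mathlib.Data.Real.Basic
import Mathlib.SetTheory.Cardinal.Finite
import HarnessLib

/-!
# The polynomial Freiman–Ruzsa theorem over `𝔽₂ⁿ` (Marton's conjecture; Gowers–Green–Manners–Tao)

Topic `Literature/Combinatorics/Additive`. Named fact (D-0014: the statement as printed, no proof):
W. T. Gowers, B. Green, F. Manners, T. Tao, *On a conjecture of Marton*, Ann. of Math. 201 (2025),
Conjecture 1.1 with Theorem 1.2 (`C = 12`): **if `A ⊂ 𝔽₂ⁿ` has `|A + A| ≤ K |A|`, then `A` is covered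
by at most `2 K^{12}` cosets of some subgroup `H ≤ 𝔽₂ⁿ` of size at most `|A|`.** (J.-J. Liao improved
`12` to `11`; we vendor the printed `12`.) A machine-checked proof exists in the external Lean project
`teorth/pfr`; it is not part of Mathlib or of this tree, so the result is a named fact here.

Model of `𝔽₂ⁿ`: `Fin n → ZMod 2` (the additive group; this is the carrier used by the route items that
consume the fact). "Covered by at most `2K^{12}` cosets of `H`" is spelled with an explicit finite set
`c` of coset representatives, `|c| ≤ 2 K^{12}` and `∀ a ∈ A, ∃ x ∈ c, a - x ∈ H` (i.e. `A ⊆ c + H`).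
`A` is taken nonempty (for `A = ∅` the printed statement is vacuous/true; `K` is then unconstrained).

Grounds `Summit.QuantumAdvantage.QuantumAdvantage.Theses.AreaUncertainty.BoundedAreaCore`, whose first
hypothesis is this statement with an unspecified exponent `C₀` (take `C₀ = 12`).

Deliberately NOT here: the entropic formulation (GGMT Thm 1.8), odd characteristic (GGMT's companion
paper), the weak PFR over `ℤ^D` (GGMT Thm 1.3), Liao's constant `11`.
-/

namespace Literature.Combinatorics.Additive

open scoped Pointwise

/-- **Polynomial Freiman–Ruzsa theorem over `𝔽₂ⁿ`** (Marton's conjecture, proved by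
Gowers–Green–Manners–Tao): for every `n`, every nonempty `A ⊂ 𝔽₂ⁿ` and every real `K` with
`|A + A| ≤ K |A|`, there are a subgroup `H ≤ 𝔽₂ⁿ` with `|H| ≤ |A|` and a set `c` of at most `2 K^{12}`
translates such that `A ⊆ c + H` (every `a ∈ A` lies in `x + H` for some `x ∈ c`).
[cite: GowersEtAl2025, Theorem 1.2 (Conjecture 1.1 with C = 12)] -/
def polynomialFreimanRuzsa : Prop :=
  ∀ (n : ℕ) (A : Finset (Fin n → ZMod 2)) (K : ℝ), A.Nonempty →
    (((A + A).card : ℝ) ≤ K * A.card) →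
    ∃ (H : AddSubgroup (Fin n → ZMod 2)) (c : Finset (Fin n → ZMod 2)),
      (c.card : ℝ) ≤ 2 * K ^ 12 ∧ Nat.card H ≤ A.card ∧ ∀ a ∈ A, ∃ x ∈ c, a - x ∈ H

end Literature.Combinatorics.Additive
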